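import Mathlib.Tactic.Linarith
import Mathlib.Tactic.NormNum
import Mathlib.Tactic.Ring
import Mathlib.Data.Finset.Card
import Mathlib.Data.Fintype.Prod
import HarnessLib

/-!
# The (0,1) cell of the ι-window, XXVI-B: the product ground `B₁ × B₂`, XIII (ADDENDUM 1) — axes of contact 3 and 4: the chain point
# `x y = z t^k`, the `A_{k−1}`-curves, PROPOSITION FLEX (report [XXVI] §14): arithmetic shadows

Family `hodge`, b2b cell `hweil` (helper of item stmt-HodgeConjecture-2524). Companion (`pg13a_*`) of `WeilTypeLadderH2ProductGroundThirteen.lean`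
(same seat). Report `run/shared/lean/b2b/hodge-weil/b2b-hweil-pv1-g38/H2-ZERO-ONE-26.md` ([XXVI]) §14 (ADDENDUM 1). HONEST FRAMING: census results
inside the ladder's H2 test ((0,1) cell) on the SPECIAL fourfold `X₀ = B₁ × B₂`; nothing here is a rung; no case of the Hodge conjecture is proved; no
statement of [Markman 2025] / [Perry 2026] / [EdGFS 2025] is used.
-/

-- mandated namespace `Summit.HodgeConjecture.HodgeConjecture.…` (Problem = Summit) trips `linter.dupNamespace`; the lakefile disables it
-- tree-wide (weak option), restated here so stand-alone elaboration is warning-free too.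
set_option linter.dupNamespace false

namespace Summit.HodgeConjecture.HodgeConjecture.WeilTypeLadder

section ProductGroundThirteenAdd1

/-- **[XXVI] 14.1, the contact types' Euler bookkeeping.** A line meets the Kummer quartic in length `4 = 3 + 1 = 4 + 0 = 2 + 1 + 1`; on the
eightfold blow-up (`e = 8`, fibre genus 5) the singular fibres sum to `24`: contact 3 gives the HEXAGON T-fibre (two genus-2 curves, four (−2)-curves,
six nodes: `χ = −2 −2 + 4·2 − 6 = −2`, `e = −2 + 8 = 6`) and `16 + 6 + 2 = 24` (one ordinary tangential member; `ℓ·Km^∨ = 3 + 1 = 4`); contact 4 gives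
the OCTAGON (`χ = −4 + 6·2 − 8 = 0`, `e = 8`) and `16 + 8 = 24` (no ordinary tangential member); `Θ̃_x` passes through `c − 1` of the `c` infinitely-near
points at `z` and one at `−z` (plus one simple base point when `c = 3`): `f₁·Θ̃_x = 4 − ((c−1) + 1 + (4 − c)) = 0` for `c = 3` and `4 − (3 + 1) = 0` for `c = 4`.
[`norm_num`] -/
theorem pg13a_contact_euler :
    (3 + 1 = (4:ℤ)) ∧ (4 + 0 = (4:ℤ)) ∧ (-2 - 2 + 4 * 2 - 6 = (-2:ℤ)) ∧ (-2 + 8 = (6:ℤ)) ∧ (16 + 6 + 2 = (24:ℤ)) ∧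
    (-4 + 6 * 2 - 8 = (0:ℤ)) ∧ (0 + 8 = (8:ℤ)) ∧ (16 + 8 = (24:ℤ)) ∧ (4 - ((3 - 1) + 1 + (4 - 3)) = (0:ℤ)) ∧ (4 - (3 + 1) = (0:ℤ)) := by
  norm_num

/-- **LEMMA CH_k ([XXVI] 14.2 (c)), the local class groups along the `A_{k−1}`-curves.** The Cartan determinants: `A₁`: `2`; `A₂`: `(−2)(−2) − 1 = 3`;
`A₃`: `det [[−2,1,0],[1,−2,1],[0,1,−2]] = −4` (order `4`); the class map of `A₂`, `(d₁,d₂) ↦ d₁ − d₂ (mod 3)`, kills the relation vectors `(−2,1)` and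
`(1,−2)` (`−3` and `3`); the three 'z-special' patterns `(1,0,0)`, `(0,1,0)`, `(0,0,1)` have degree vectors `(−1,0)`, `(1,−1)`, `(0,1)` with the SAME class
`2 (mod 3)` — one Weil class, three admissible lifts. [`decide` / `norm_num`] -/
theorem pg13a_Ak_classgroups :
    ((-2:ℤ) * (-2) - 1 * 1 = 3) ∧ ((-2:ℤ) * ((-2) * (-2) - 1 * 1) - 1 * (1 * (-2) - 1 * 0) = -4) ∧
    (((-2:ℤ) - 1) % 3 = 0 ∧ ((1:ℤ) - (-2)) % 3 = 0) ∧
    ((((0:ℤ) - 1) - (0 - 0)) % 3 = 2 ∧ (((1:ℤ) - 0) - (0 - 1)) % 3 = 2 ∧ (((0:ℤ) - 0) - (1 - 0)) % 3 = 2) := by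
  norm_num

/-- **LEMMA CH_k ([XXVI] 14.2 (c)), the admissible degree vectors for `k = 3`.** The exact Čech table finds the lifts with finite `R¹π_*` and reflexive
`π_*` to be exactly the seven vectors `(d₁,d₂)` with `|d₁|, |d₂|, |d₁ + d₂| ≤ 1` — zero and the six shortest representatives of the two non-trivial
classes of `ℤ/3`. Here: that set, cut out of `{−1,0,1}²` by `|d₁ + d₂| ≤ 1`, has exactly `9 − 2 = 7` elements. [`decide`] -/
theorem pg13a_admissible_weights :
    (((Finset.univ : Finset (Fin 3 × Fin 3)).filter
        (fun p => ((p.1 : ℤ) - 1) + ((p.2 : ℤ) - 1) ≤ 1 ∧ -1 ≤ ((p.1 : ℤ) - 1) + ((p.2 : ℤ) - 1))).card = 7) ∧ (9 - 2 = (7:ℕ)) := by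
  refine ⟨by decide, by norm_num⟩

/-- **PROPOSITION FLEX ([XXVI] 14.3), the degrees and rows.** With the π-generated lift (the `1` at `ε_c`): on the T-member's component
`Θ̃_x = θ₁ − (ε₁+…+ε_{c−1})^z − ε₁^{−z} (− e_p)` the degree is `2 + 0 + 0 (+ x_p)`: `3` for the even hull (`c = 3`, `x_p = 1`, `χ = 2` per component), `2`
for `𝓛_z` (`χ = 1`); on the verticals in `V_z` the degree is `4 − 4·α_c`: `4` (pair `χ = 6`) or `0` (pair `χ = −2`); so the rows are those of PROPOSITION TAN:
P7 `4 − 2 − (1+1) = 0`, P8 `4 − (−2) − 2 = 4`, P4_T `4 − (−2) − 4 = 2`; and the ordinary tangential component through the whole jet has degree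
`2 + (α₁+α₂+α₃) + x = 2 + 1 = 3`. [`norm_num`] -/
theorem pg13a_flex_rows :
    (2 + 0 + 0 + 1 = (3:ℤ)) ∧ (2 + 0 + 0 + 0 = (2:ℤ)) ∧ (3 + 1 - 2 = (2:ℤ)) ∧ (2 + 1 - 2 = (1:ℤ)) ∧ (4 - 4 * 0 = (4:ℤ)) ∧ (4 - 4 * 1 = (0:ℤ)) ∧
    (2 * (4 + 1 - 2) = (6:ℤ)) ∧ (2 * (0 + 1 - 2) = (-2:ℤ)) ∧ (4 - 2 - (1 + 1) = (0:ℤ)) ∧ (4 - (-2) - 2 = (4:ℤ)) ∧ (4 - (-2) - 4 = (2:ℤ)) ∧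
    (2 + (0 + 0 + 1) + 0 = (3:ℤ)) := by
  norm_num

/-- **PROPOSITION FLEX / 14.4, the void counts and the contact bound.** Type dimensions: asymptotic tangents `2 + 0 = 2`, four-point contact `1`,
trope-tangent `1`; against a non-degenerate partner `2 + 4 + 3 − 5 = 4 ≥ 2` and `1 + 4 + 3 − 5 = 3 ≥ 2`; the contact order of a line with a quartic
surface containing no line is at most `4`, so the node-free axes are exactly the contact types `1, 2, 3, 4` — all now with ROWS. [`norm_num`/`omega`] -/
theorem pg13a_contact_void :
    (2 + 4 + 3 - 5 = (4:ℕ)) ∧ (1 + 4 + 3 - 5 = (3:ℕ)) ∧ (2 ≤ (4:ℕ)) ∧ (2 ≤ (3:ℕ)) ∧ (∀ c : ℕ, 1 ≤ c → c ≤ 4 → (c = 1 ∨ c = 2 ∨ c = 3 ∨ c = 4)) := by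
  refine ⟨by norm_num, by norm_num, by norm_num, by norm_num, ?_⟩
  intro c h1 h4; omega

end ProductGroundThirteenAdd1

end Summit.HodgeConjecture.HodgeConjecture.WeilTypeLadder
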